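import Mathlib
import Literature.NumberTheory.LFunctions.Zhang2022.Section8Step8u016
import Literature.NumberTheory.LFunctions.Zhang2022.Section17Eq171Edges
import Literature.NumberTheory.LFunctions.Zhang2022.Section14Eq143Zinv
import Literature.NumberTheory.LFunctions.Zhang2022.Section16I3plusTheta2
import Literature.NumberTheory.LFunctions.Zhang2022.TypedSection17NuStarBound
import HarnessLib

/-!
# Zhang (2022) §16 p. 89: moving `I₃⁺(ψ)` from `𝔍(α)` to `𝔍(1)` —
# `Σ_{ψ∈Ψ₁}(p_ψt₀)^{β₁}I₃⁺(ψ) = Θ₂(β₁,𝐤₂*,𝐚₂*) + O(ε)` as an edge from Proposition 2.2 (i)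

Topic `Literature/NumberTheory/LFunctions/Zhang2022` (Landau–Siegel audit tree; verdict-neutral).
Y. Zhang, *Discrete mean estimates and the Landau–Siegel zero*, arXiv:2211.02515v1 (2022)
[Zhang2022LandauSiegel] — **an unrefereed manuscript under adjudication; nothing in this file asserts or
denies its Theorems 1–2.** ZHANG-L discharge lane (WP16), leaf `Typed.Section16A.Step16_u010 c′`
(node `Z22:§16.u010`, §16 p. 89, tex L4425–L4449):

> (16.1) "In a way similar to the proof of (15.6), we can move the segment `𝔍(α)` to `𝔍(1)` …"
> u010 "We can rewrite (16.1) as `Φ₂ = Θ₂(β₁,𝐤₂*,𝐚₂*) + o(p)` with `κ₂* = κ₂ ∗ b₁` and `a₂* = g̃₂`."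

`Skeleton.Theta2` sums over `Ψ₁` and integrates over `𝔍(1)`, so for u010 the extension of the sum from
`Ψ₁` to `Ψ` asserted in (16.1) is not needed: what is needed is the contour move for
`I₃⁺(ψ) = (1/2πi)∫_{𝔍(α)} 𝒦₂(s,ψ)ω(s)ds` and the Dirichlet-series identity on `𝔍(1)`
(`Step16u010.sum_I3pm_one_eq_Theta2`, file `Section16I3plusTheta2`). This file does the move — the §16
twin of the tree's `Z22:§8.u016` (`Step8u016.step8u016_of`, whose sizes and mechanism are reused):

* `differentiable_Kchar`, `norm_Kchar_le` — `K(w,θ) = Σ_{n<2P₄} θ(n)n^{−w}g*(P₄/n)` is entire and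
  `≤ (2P₄+1)²` in modulus for `Re w ≥ −1` (`|θ| ≤ 1`);
* `norm_Zpc_inv_le` — `|Z(s,χψ)⁻¹| ≤ e³·Dpt₀` on `½ ≤ σ ≤ 3/2`, `|t − 2πt₀| ≤ 𝓛₁` (the tree's
  `Typed.Sec14.Eq143.norm_Zfac_inv_le_of_isPrimitive` at the primitive `χψ (mod Dp)`);
* `differentiableOn_calK2_omega` — for `ψ ∈ Ψ₁` the integrand `𝒦₂(s,ψ)ω(s)`
  (`𝒦₂ = Z(s,χψ)⁻¹(L(s+β₁,ψ)/L(s,ψ))B(s,ψ)N(s+β₃,ψ)K(1−s−β₂,ψ̄)`, u001) is HOLOMORPHIC on the closed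
  rectangle `[½+α, 3/2] × [2πt₀−𝓛₁, 2πt₀+𝓛₁]`: `L(s,ψ) ≠ 0` there because "by Proposition 2.2" the
  zeros of `L(s,ψ)L(s,ψχ)` in `Ω` lie on `σ = ½` (`Step8u016.LFunction_ne_zero_of_onLine`);
* `norm_calK2_omega_le`, `norm_calK2_omega_le_uniform` — on the horizontal sides the integrand is
  `≤ K·P¹²·exp(3C𝓛⁹(1+9log𝓛))·e^{−𝓛¹⁰/4}` (`|L(s,ψ)|⁻¹ ≤ exp(C(1+log(1/α))ℒ)` by the tree's
  `DirichletDisc.exp_neg_le_norm_LFunction`, the other factors polynomial in `P`, the Gaussian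
  `|ω| ≤ 6e^{−𝓛¹⁰/4}`);
* `sum_I3plus_sub_Theta2_le_of` — **`‖Σ_{ψ∈Ψ₁}(p_ψt₀)^{β₁}I₃⁺(ψ) − Θ₂(β₁,𝐤₂*,𝐚₂*)‖ ≤ e^{−𝓛¹⁰/16}`**
  for all large `D`, from `Skeleton.Prop22i` (Cauchy's theorem per `ψ` via the tree's
  `Section7aStatements.norm_intJ_sub_intJ_le`, `#Ψ₁ ≤ 𝔓 ≤ 4P²`, `Step8u016.growth_le`).

Theorems only; no definitions, no named facts; axioms standard. WHAT THIS IS NOT: a proof of u010 or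
(16.1) (the residue step u002 and `I₃⁻ ≪ ε` (u004) are separate), nor any claim about Theorems 1–2 of
the source or about Landau–Siegel zeros.

## References

* Y. Zhang, arXiv:2211.02515v1 (2022), §16 pp. 88–89 (u001–u010, (16.1)), §8 p. 43 (the template
  move), §2 (2.7)–(2.15). [cite: Zhang2022LandauSiegel, §16 p.89 (16.1), u010]
* H. L. Montgomery, R. C. Vaughan, *Multiplicative Number Theory I* (2007), Lemma 12.6 (the lower bound
  for `|L(s,χ)|` off the zeros, tree file `DirichletLFunctionLowerBoundOffZeros`).
  [cite: MontgomeryVaughan2007, Lemma 12.6]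
-/

noncomputable section

open Complex Real Set Metric MeasureTheory
open Literature.NumberTheory.LFunctions.Zhang2022.Skeleton
open Literature.NumberTheory.LFunctions.Zhang2022.Typed.Section16A

namespace Literature.NumberTheory.LFunctions.Zhang2022.Step16u010

open Literature.NumberTheory.LFunctions.Zhang2022

/-! ## `K(w,θ)`: holomorphy and the trivial bound -/

section KcharTools

variable {D : ℕ}

/-- `K(w,θ) = Σ_{n<2P₄} θ(n)n^{−w}g*(P₄/n)` (§6) is entire in `w` (a finite Dirichlet polynomial over
`n ≥ 1`). [cite: Zhang2022LandauSiegel, §6 Lemma 6.1] -/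
theorem differentiable_Kchar (θ : ℕ → ℂ) : Differentiable ℂ (Kchar D θ) := by
  have h : Kchar D θ = fun w => ∑ n ∈ Finset.Ico 1 ⌈2 * P4 D⌉₊,
      (θ n * (gstar D (P4 D / n) : ℂ)) * (n : ℂ) ^ (-w) := by
    funext w; rw [Kchar]; refine Finset.sum_congr rfl fun n _ => ?_; ring
  rw [h]
  refine Differentiable.fun_sum fun n hn => ?_
  have hn0 : (n : ℂ) ≠ 0 := Nat.cast_ne_zero.mpr (by have := (Finset.mem_Ico.mp hn).1; omega)
  exact (differentiable_id.neg.const_cpow (Or.inl hn0)).const_mul _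

/-- **`|K(w,θ)| ≤ (2P₄+1)²`** for `Re w ≥ −1` and `|θ| ≤ 1` (fewer than `2P₄+1` terms, each of
modulus `≤ n ≤ 2P₄`). [cite: Zhang2022LandauSiegel, §6 Lemma 6.1] -/
theorem norm_Kchar_le (hℓ : 0 < ell D) {θ : ℕ → ℂ} (hθ : ∀ n, ‖θ n‖ ≤ 1) {w : ℂ}
    (hw : -1 ≤ w.re) : ‖Kchar D θ w‖ ≤ (2 * P4 D + 1) ^ 2 := by
  have hP4 : 0 ≤ P4 D := Typed.Section16ALeaves.P4_nonneg D
  rw [Kchar]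
  have hterm : ∀ n ∈ Finset.Ico 1 ⌈2 * P4 D⌉₊,
      ‖θ n * (n : ℂ) ^ (-w) * (gstar D (P4 D / n) : ℂ)‖ ≤ 2 * P4 D + 1 := by
    intro n hn
    obtain ⟨hn1, hn2⟩ := Finset.mem_Ico.mp hn
    have hnlt : (n : ℝ) < 2 * P4 D := Nat.lt_ceil.mp hn2
    have hn1' : (1 : ℝ) ≤ n := by exact_mod_cast hn1
    rw [norm_mul, norm_mul, Complex.norm_natCast_cpow_of_pos hn1]
    have hpow : (n : ℝ) ^ (-w).re ≤ (n : ℝ) ^ (1 : ℝ) :=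
      Real.rpow_le_rpow_of_exponent_le hn1' (by rw [Complex.neg_re]; linarith)
    rw [Real.rpow_one] at hpow
    have hg := Typed.Section17.norm_gstar_le_one hℓ (P4 D / n)
    calc ‖θ n‖ * (n : ℝ) ^ (-w).re * ‖(gstar D (P4 D / n) : ℂ)‖
        ≤ 1 * (2 * P4 D + 1) * 1 := by
          refine mul_le_mul (mul_le_mul (hθ n) (by linarith) (by positivity) zero_le_one) hg
            (norm_nonneg _) (by positivity)
      _ = 2 * P4 D + 1 := by ring
  have hcard : ((Finset.Ico 1 ⌈2 * P4 D⌉₊).card : ℝ) ≤ 2 * P4 D + 1 := by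
    rw [Nat.card_Ico]
    have h1 : ((⌈2 * P4 D⌉₊ - 1 : ℕ) : ℝ) ≤ (⌈2 * P4 D⌉₊ : ℝ) := by exact_mod_cast Nat.sub_le _ _
    have h2 : (⌈2 * P4 D⌉₊ : ℝ) < 2 * P4 D + 1 := Nat.ceil_lt_add_one (by positivity)
    linarith
  calc ‖∑ n ∈ Finset.Ico 1 ⌈2 * P4 D⌉₊, θ n * (n : ℂ) ^ (-w) * (gstar D (P4 D / n) : ℂ)‖
      ≤ ∑ n ∈ Finset.Ico 1 ⌈2 * P4 D⌉₊, ‖θ n * (n : ℂ) ^ (-w) * (gstar D (P4 D / n) : ℂ)‖ :=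
        norm_sum_le _ _
    _ ≤ ∑ n ∈ Finset.Ico 1 ⌈2 * P4 D⌉₊, (2 * P4 D + 1) := Finset.sum_le_sum hterm
    _ = (Finset.Ico 1 ⌈2 * P4 D⌉₊).card * (2 * P4 D + 1) := by rw [Finset.sum_const, nsmul_eq_mul]
    _ ≤ (2 * P4 D + 1) * (2 * P4 D + 1) := mul_le_mul_of_nonneg_right hcard (by positivity)
    _ = (2 * P4 D + 1) ^ 2 := by ring

/-- `P₄ = PT⁻²t₀ ≤ P²` for `𝓛 ≥ 3` (`T ≥ 1`, `t₀ ≤ P`). [cite: Zhang2022LandauSiegel, §6 p.30] -/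
theorem P4_le_bigP_sq (hℓ : 3 ≤ ell D) : P4 D ≤ bigP D ^ 2 := by
  have hP0 : 0 < bigP D := Real.exp_pos _
  have hT1 : 1 ≤ bigT D ^ 2 :=
    one_le_pow₀ (by rw [bigT]; exact Real.one_le_exp (Real.rpow_nonneg (Real.log_natCast_nonneg D) _))
  have ht0 : 0 ≤ t0 D := pow_nonneg (Real.log_natCast_nonneg D) _
  have h1 : bigP D / bigT D ^ 2 ≤ bigP D := div_le_self hP0.le hT1
  calc P4 D = bigP D / bigT D ^ 2 * t0 D := rfl
    _ ≤ bigP D * bigP D := mul_le_mul h1 (Step8u016.t0_le_bigP hℓ) ht0 hP0.le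
    _ = bigP D ^ 2 := by ring

end KcharTools

/-! ## `Z(s,χψ)⁻¹` on the rectangle and the holomorphy of `𝒦₂(s,ψ)ω(s)` -/

section Holomorphy

variable (c' : ℝ) {D : ℕ} [NeZero D] {χ : DirichletCharacter ℂ D} (x : Chr D)

/-- **`|Z(s,χψ)⁻¹| ≤ e³·Dpt₀`** for `½ ≤ σ ≤ 3/2`, `|t − 2πt₀| ≤ 𝓛₁`, `D ≥ 3`, `χ` primitive
(`χψ` is primitive mod `Dp`; the tree's `|Z(s,θ)⁻¹| ≤ e³(kt₀)^{σ−½}` with `σ − ½ ≤ 1`).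
[cite: Zhang2022LandauSiegel, §2 (2.5); §7 p.34] -/
theorem norm_Zpc_inv_le (hD : 3 ≤ D) (hp : χ.IsPrimitive) {s : ℂ} (hσ1 : 1 / 2 ≤ s.re)
    (hσ2 : s.re ≤ 3 / 2) (ht : |s.im - 2 * π * t0 D| ≤ ell1 D) :
    ‖(Zpc χ x s)⁻¹‖ ≤ Real.exp 3 * ((D : ℝ) * x.p * t0 D) := by
  have hprim := psiChiPrimitive_holds D χ x hD hp
  have hp2 : 2 ≤ x.p := x.prime.two_le
  have hk : 2 ≤ D * x.p := le_trans hp2 (Nat.le_mul_of_pos_left _ (by omega))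
  have hℓ : 1 ≤ ell D := (one_lt_ell hD).le
  have hℓ9 : 1 ≤ ell D ^ 9 := one_le_pow₀ hℓ
  have h := Typed.Sec14.Eq143.norm_Zfac_inv_le_of_isPrimitive hD hprim hk hσ1
    (by linarith) ht
  rw [Zpc]
  refine h.trans ?_
  have hk1 : (1 : ℝ) ≤ ((D * x.p : ℕ) : ℝ) := by exact_mod_cast (show 1 ≤ D * x.p by omega)
  have ht0 : 1 ≤ t0 D := by rw [t0]; exact one_le_pow₀ hℓ
  have hbase : 1 ≤ ((D * x.p : ℕ) : ℝ) * t0 D := by nlinarith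
  have hexp : (((D * x.p : ℕ) : ℝ) * t0 D) ^ (s.re - 1 / 2) ≤ (((D * x.p : ℕ) : ℝ) * t0 D) ^ (1 : ℝ) :=
    Real.rpow_le_rpow_of_exponent_le hbase (by linarith)
  rw [Real.rpow_one] at hexp
  refine (mul_le_mul_of_nonneg_left hexp (Real.exp_pos 3).le).trans (le_of_eq ?_)
  push_cast; ring

/-- **The integrand `𝒦₂(s,ψ)ω(s)` of `I₃⁺` is holomorphic on the closed rectangle
`[½+α, 3/2] × [2πt₀−𝓛₁, 2πt₀+𝓛₁]`** for `ψ ∈ Ψ₁` with the zeros of `L(s,ψ)L(s,ψχ)` in `Ω` on the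
line (the body of Proposition 2.2 (i) at `ψ`), `D ≥ 3`, `χ` primitive, `0 < α ≤ 1`, `𝓛₁ < 2πt₀`:
`Z(s,χψ)⁻¹` is holomorphic on `Im s > 0`, `L(·,ψ)`, `B`, `N`, `K`, `ω` are entire, and `L(s,ψ) ≠ 0` on
the rectangle (`Step8u016.LFunction_ne_zero_of_onLine`). [cite: Zhang2022LandauSiegel, §16 (16.1) p.89] -/
theorem differentiableOn_calK2_omega (hD : 3 ≤ D) (hp : χ.IsPrimitive)
    (h22 : ∀ s ∈ prodZeroSetOmega χ x, s.re = 1 / 2)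
    (hα0 : 0 < alpha D) (hα1 : alpha D ≤ 1) (hwin : ell1 D < 2 * π * t0 D) :
    DifferentiableOn ℂ (fun s => calK2 c' χ x s * omegaW D s)
      (Set.uIcc (1 / 2 + alpha D) (1 / 2 + 1) ×ℂ
        Set.uIcc (2 * π * t0 D - ell1 D) (2 * π * t0 D + ell1 D)) := by
  intro s hs
  have hre : 1 / 2 + alpha D ≤ s.re ∧ s.re ≤ 1 / 2 + 1 := by
    have h := hs.1
    rw [Set.uIcc_of_le (by linarith)] at h
    exact h
  have hℓ1 : 0 ≤ ell1 D := pow_nonneg (Real.log_natCast_nonneg D) _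
  have him : 2 * π * t0 D - ell1 D ≤ s.im ∧ s.im ≤ 2 * π * t0 D + ell1 D := by
    have h := hs.2
    rw [Set.uIcc_of_le (by linarith)] at h
    exact h
  have him0 : 0 < s.im := by linarith
  have himw : |s.im - 2 * π * t0 D| < ell1 D + 2 := by
    rw [abs_lt]; constructor <;> linarith
  have hL : x.ψ.LFunction s ≠ 0 := Step8u016.LFunction_ne_zero_of_onLine h22 (by linarith) himw
  have hprim := psiChiPrimitive_holds D χ x hD hp
  have hLd := DirichletCharacter.differentiable_LFunction x.ψ_ne_one
  have hZ : DifferentiableAt ℂ (fun s => (Zpc χ x s)⁻¹) s := by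
    unfold Zpc
    exact (GammaFactor.differentiableAt_Zfac (psiChi χ x) him0).inv
      (GammaFactor.Zfac_ne_zero hprim him0)
  have hL1 : DifferentiableAt ℂ (fun s => x.ψ.LFunction (s + beta1 c' D)) s :=
    (hLd.comp (differentiable_id.add_const _)).differentiableAt
  have hL0 : DifferentiableAt ℂ (fun s => x.ψ.LFunction s) s := hLd.differentiableAt
  have hB : DifferentiableAt ℂ (Bpoly χ x) s :=
    (Typed.Section17.differentiable_Bpoly χ x).differentiableAt
  have hN : DifferentiableAt ℂ (fun s => Nchar D (psiFn x) (s + beta3 c' D)) s :=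
    ((Typed.Section17.differentiable_Nchar (psiFn x)).comp
      (differentiable_id.add_const _)).differentiableAt
  have hK : DifferentiableAt ℂ (fun s => Kchar D (psiBarFn x) (1 - s - beta2 c' D)) s :=
    ((differentiable_Kchar (psiBarFn x)).comp
      (((differentiable_const (1 : ℂ)).sub differentiable_id).sub_const _)).differentiableAt
  have hω : DifferentiableAt ℂ (omegaW D) s := (Section7aStatements.differentiable_omegaW D) s
  have hfun : (fun s => calK2 c' χ x s * omegaW D s) = fun s =>
      (Zpc χ x s)⁻¹ * (x.ψ.LFunction (s + beta1 c' D) / x.ψ.LFunction s) * Bpoly χ x s *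
        Nchar D (psiFn x) (s + beta3 c' D) * Kchar D (psiBarFn x) (1 - s - beta2 c' D) *
        omegaW D s := by
    funext s; rfl
  rw [hfun]
  exact (((((hZ.mul (hL1.div hL0 hL)).mul hB).mul hN).mul hK).mul hω).differentiableWithinAt

end Holomorphy

/-! ## The size of `𝒦₂(s,ψ)ω(s)` on the horizontal sides -/

section EdgeBound

variable (c' : ℝ) {D : ℕ} [NeZero D] {χ : DirichletCharacter ℂ D} (x : Chr D)

omit [NeZero D] in
/-- `D ≤ P` (`D = e^{𝓛} ≤ e^{𝓛⁹} = P` for `𝓛 ≥ 1`; `D ≥ 3`). [cite: Zhang2022LandauSiegel, §2 (2.6)] -/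
theorem natCast_le_bigP (hD : 3 ≤ D) : (D : ℝ) ≤ bigP D := by
  have hD0 : (0 : ℝ) < D := by exact_mod_cast (show 0 < D by omega)
  have hℓ : 1 ≤ ell D := (one_lt_ell hD).le
  have h9 : ell D ≤ ell D ^ 9 := le_self_pow₀ hℓ (by norm_num)
  calc (D : ℝ) = Real.exp (Real.log D) := (Real.exp_log hD0).symm
    _ ≤ Real.exp (ell D ^ 9) := Real.exp_le_exp.mpr (by rw [ell] at h9 ⊢; exact h9)
    _ = bigP D := rfl

/-- **The integrand on the horizontal sides.** For `ψ ∈ Ψ₁` with the zeros of `L(s,ψ)L(s,ψχ)` in `Ω`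
on the line, `D ≥ 3`, `χ` primitive, `0 < α ≤ 1/6`, `|c′|α𝓛 ≤ 1`, `𝓛 ≥ 3`, and `s = u + it` with
`½+α ≤ u ≤ 3/2`, `|t − 2πt₀| ≤ 𝓛₁`, `t ≥ 1`:
`|𝒦₂(s,ψ)ω(s)| ≤ [e³Dpt₀]·[p(|t|+5)Z]·exp(C(1+log(1/α))(log p + log(|t|+4)))·[K_B(P+1)²]·(P+1)
 ·(2P₄+1)²·(√π/𝓛₂)exp(((u−½)² − (t−2πt₀)²)/(4𝓛₂²))`, `K_B = (1+|ι₂|)(|ι₃|+|ι₄|)`, `C` the absolute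
constant of `DirichletDisc.exp_neg_le_norm_LFunction`. [cite: Zhang2022LandauSiegel, §16 (16.1) p.89] -/
theorem norm_calK2_omega_le {C : ℝ}
    (hC : ∀ (q : ℕ) [NeZero q] (θ : DirichletCharacter ℂ q), θ ≠ 1 → ∀ t σ d : ℝ,
      1 / 2 ≤ σ → σ ≤ 2 → 0 < d → d ≤ 1 →
        (∀ ρ ∈ DirichletDisc.discZeros θ t, ∀ y ∈ Icc σ 2, d ≤ ‖(y : ℂ) + t * I - ρ‖) →
          Real.exp (-(C * (1 + Real.log (1 / d)) * (Real.log q + Real.log (|t| + 4)))) ≤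
            ‖θ.LFunction ((σ : ℂ) + t * I)‖)
    (h22 : ∀ s ∈ prodZeroSetOmega χ x, s.re = 1 / 2) (hD : 3 ≤ D) (hp : χ.IsPrimitive)
    (hℓ3 : 3 ≤ ell D) (hα0 : 0 < alpha D) (hα : alpha D ≤ 1 / 6)
    (hc : |c'| * (alpha D * ell D) ≤ 1)
    {u t : ℝ} (hu1 : 1 / 2 + alpha D ≤ u) (hu2 : u ≤ 3 / 2) (ht : |t - 2 * π * t0 D| ≤ ell1 D)
    (ht1 : 1 ≤ t) :
    ‖calK2 c' χ x ((u : ℂ) + t * I) * omegaW D ((u : ℂ) + t * I)‖ ≤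
      (Real.exp 3 * ((D : ℝ) * x.p * t0 D)) * ((x.p : ℝ) * (|t| + 5) * DirichletDisc.Zc) *
        Real.exp (C * (1 + Real.log (1 / alpha D)) * (Real.log x.p + Real.log (|t| + 4))) *
        ((1 + ‖iota2‖) * (‖iota3‖ + ‖iota4‖) * (bigP D + 1) ^ 2) * (bigP D + 1) *
        (2 * P4 D + 1) ^ 2 *
        (Real.sqrt π / ell2 D * Real.exp (((u - 1 / 2) ^ 2 - (t - 2 * π * t0 D) ^ 2) /
          (4 * ell2 D ^ 2))) := by
  set s : ℂ := (u : ℂ) + t * I with hs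
  have hsre : s.re = u := by simp [hs]
  have hsim : s.im = t := by simp [hs]
  have ht0 : 0 < t := by linarith
  have hp0 : (0 : ℝ) < x.p := by exact_mod_cast x.prime.pos
  have hℓ : 1 ≤ ell D := (one_lt_ell hD).le
  have hℓ0 : 0 < ell D := by linarith
  have hℓ2 : 2 ≤ Real.log D := by rw [← ell]; linarith
  have ht0D : 0 < t0 D := pow_pos hℓ0 _
  have hZc : 1 ≤ DirichletDisc.Zc := DirichletDisc.one_le_Zc
  obtain ⟨hb1, -, -⟩ := Step8u016.abs_b_le_one c' hα0.le hα hc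
  obtain ⟨e1, -, -⟩ := Section8aStatements.beta_eq_b_mul_I c' D
  -- the factors of `𝒦₂`
  have hF1 : ‖(Zpc χ x s)⁻¹‖ ≤ Real.exp 3 * ((D : ℝ) * x.p * t0 D) :=
    norm_Zpc_inv_le x hD hp (by rw [hsre]; linarith) (by rw [hsre]; linarith) (by rw [hsim]; exact ht)
  have hreI : s.re ∈ Icc (1 / 2 : ℝ) 2 := by rw [hsre]; constructor <;> linarith
  have hL1 : ‖x.ψ.LFunction (s + beta1 c' D)‖ ≤ x.p * (|t| + 5) * DirichletDisc.Zc := by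
    rw [e1, ← hsim]; exact Step8u016.norm_LFunction_shift_le x hreI hb1
  -- the lower bound for `L(s,ψ)`
  have hα1 : alpha D ≤ 1 := by linarith
  have hdist := DirichletDisc.dist_segment_of_re_le (χ := x.ψ) (t := t) (σ := u) (d := alpha D)
    (fun ρ hρ => by rw [Step8u016.discZeros_re_eq_half h22 ht ρ hρ]; linarith)
  have hLlow := hC x.p x.ψ x.ψ_ne_one t u (alpha D) (by linarith) (by linarith) hα0 hα1 hdist
  set E : ℝ := Real.exp (C * (1 + Real.log (1 / alpha D)) * (Real.log x.p + Real.log (|t| + 4)))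
    with hE
  have hE0 : 0 < E := Real.exp_pos _
  have hLs0 : 0 < ‖x.ψ.LFunction s‖ := lt_of_lt_of_le (Real.exp_pos _) hLlow
  have hF4 : ‖(x.ψ.LFunction s)⁻¹‖ ≤ E := by
    rw [norm_inv, inv_le_comm₀ hLs0 hE0, hE, ← Real.exp_neg]
    exact hLlow
  -- the Dirichlet polynomials
  set KB : ℝ := (1 + ‖iota2‖) * (‖iota3‖ + ‖iota4‖) with hKB
  have hKB0 : 0 ≤ KB := by rw [hKB]; positivity
  have hP0 : 0 < bigP D := Real.exp_pos _
  have hBp : ‖Bpoly χ x s‖ ≤ KB * (bigP D + 1) ^ 2 :=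
    Typed.Section17.norm_Bpoly_le_trivial χ x hℓ2 (by rw [hsre]; linarith)
  have hNp : ‖Nchar D (psiFn x) (s + beta3 c' D)‖ ≤ bigP D + 1 :=
    Typed.Section17.norm_Nchar_le_trivial x hℓ3 (by
      rw [Complex.add_re, hsre, show (beta3 c' D).re = 0 by simp [beta3]]; linarith)
  have hKp : ‖Kchar D (psiBarFn x) (1 - s - beta2 c' D)‖ ≤ (2 * P4 D + 1) ^ 2 :=
    norm_Kchar_le hℓ0 (fun n => by rw [psiBarFn, Complex.norm_conj]; exact x.ψ.norm_le_one _)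
      (by
        rw [Complex.sub_re, Complex.sub_re, hsre, Complex.one_re,
          show (beta2 c' D).re = 0 by simp [beta2]]
        linarith)
  -- the weight
  have hℓ20 : 0 < ell2 D := pow_pos hℓ0 _
  have hω : ‖omegaW D s‖ = Real.sqrt π / ell2 D *
      Real.exp (((u - 1 / 2) ^ 2 - (t - 2 * π * t0 D) ^ 2) / (4 * ell2 D ^ 2)) := by
    have hs' : s = ((u - 1 / 2 : ℝ) : ℂ) + SmoothWeight.s0 (t0 D) + ((t - 2 * π * t0 D : ℝ) : ℂ) * I := by
      rw [hs, SmoothWeight.s0_def]; push_cast; ring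
    rw [omegaW, hs', SmoothWeight.norm_omega_segment_eq hℓ20]
  -- assembly
  have hfun : calK2 c' χ x s * omegaW D s = (Zpc χ x s)⁻¹ *
      (x.ψ.LFunction (s + beta1 c' D) * (x.ψ.LFunction s)⁻¹) * Bpoly χ x s *
      Nchar D (psiFn x) (s + beta3 c' D) * Kchar D (psiBarFn x) (1 - s - beta2 c' D) *
      omegaW D s := by
    rw [calK2, div_eq_mul_inv]
  rw [hfun, norm_mul, norm_mul, norm_mul, norm_mul, norm_mul, norm_mul, hω]
  have ht5 : 0 ≤ |t| + 5 := by linarith [abs_nonneg t]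
  have hPZ : 0 ≤ (x.p : ℝ) * (|t| + 5) * DirichletDisc.Zc :=
    mul_nonneg (mul_nonneg hp0.le ht5) (le_trans zero_le_one hZc)
  have hD0 : (0 : ℝ) ≤ D := Nat.cast_nonneg _
  have hZb : 0 ≤ Real.exp 3 * ((D : ℝ) * x.p * t0 D) :=
    mul_nonneg (Real.exp_pos 3).le (mul_nonneg (mul_nonneg hD0 hp0.le) ht0D.le)
  have hω0 : 0 ≤ Real.sqrt π / ell2 D *
      Real.exp (((u - 1 / 2) ^ 2 - (t - 2 * π * t0 D) ^ 2) / (4 * ell2 D ^ 2)) :=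
    mul_nonneg (div_nonneg (Real.sqrt_nonneg _) hℓ20.le) (Real.exp_pos _).le
  have hLL : ‖x.ψ.LFunction (s + beta1 c' D)‖ * ‖(x.ψ.LFunction s)⁻¹‖ ≤
      (x.p : ℝ) * (|t| + 5) * DirichletDisc.Zc * E :=
    mul_le_mul hL1 hF4 (norm_nonneg _) hPZ
  have h1 : ‖(Zpc χ x s)⁻¹‖ * (‖x.ψ.LFunction (s + beta1 c' D)‖ * ‖(x.ψ.LFunction s)⁻¹‖) ≤
      Real.exp 3 * ((D : ℝ) * x.p * t0 D) * ((x.p : ℝ) * (|t| + 5) * DirichletDisc.Zc * E) :=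
    mul_le_mul hF1 hLL (mul_nonneg (norm_nonneg _) (norm_nonneg _)) hZb
  have n1 : 0 ≤ Real.exp 3 * ((D : ℝ) * x.p * t0 D) *
      ((x.p : ℝ) * (|t| + 5) * DirichletDisc.Zc * E) := mul_nonneg hZb (mul_nonneg hPZ hE0.le)
  have hP10 : 0 ≤ bigP D + 1 := by linarith
  have h2 := mul_le_mul h1 hBp (norm_nonneg _) n1
  have h3 := mul_le_mul h2 hNp (norm_nonneg _) (mul_nonneg n1 (mul_nonneg hKB0 (sq_nonneg _)))
  have h4 := mul_le_mul h3 hKp (norm_nonneg _)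
    (mul_nonneg (mul_nonneg n1 (mul_nonneg hKB0 (sq_nonneg _))) hP10)
  have h5 := mul_le_mul_of_nonneg_right h4 hω0
  refine h5.trans (le_of_eq ?_)
  rw [hE, hKB]; ring

/-- **The integrand on either horizontal side, uniformly in `ψ` and `u`**: with the hypotheses of
`norm_calK2_omega_le`, `𝓛 ≥ 3` and `π|c′| ≤ 𝓛⁸`, on `s = u + i(2πt₀ ± 𝓛₁)`, `½+α ≤ u ≤ 3/2`,
`|𝒦₂(s,ψ)ω(s)| ≤ K·P¹²·exp(3C𝓛⁹(1+9log𝓛))·e^{−𝓛¹⁰/4}`, `K = e³·3·(39Z)·K_B·72·6`.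
[cite: Zhang2022LandauSiegel, §16 (16.1) p.89] -/
theorem norm_calK2_omega_le_uniform {C : ℝ} (hC0 : 0 < C)
    (hC : ∀ (q : ℕ) [NeZero q] (θ : DirichletCharacter ℂ q), θ ≠ 1 → ∀ t σ d : ℝ,
      1 / 2 ≤ σ → σ ≤ 2 → 0 < d → d ≤ 1 →
        (∀ ρ ∈ DirichletDisc.discZeros θ t, ∀ y ∈ Icc σ 2, d ≤ ‖(y : ℂ) + t * I - ρ‖) →
          Real.exp (-(C * (1 + Real.log (1 / d)) * (Real.log q + Real.log (|t| + 4)))) ≤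
            ‖θ.LFunction ((σ : ℂ) + t * I)‖)
    (x : Chr D) (h22 : ∀ s ∈ prodZeroSetOmega χ x, s.re = 1 / 2) (hD : 3 ≤ D)
    (hp : χ.IsPrimitive) (hℓ : 3 ≤ ell D) (hc : π * |c'| ≤ ell D ^ 8)
    {u : ℝ} (hu1 : 1 / 2 + alpha D ≤ u) (hu2 : u ≤ 1 / 2 + 1) {t : ℝ}
    (ht : t = 2 * π * t0 D + ell1 D ∨ t = 2 * π * t0 D - ell1 D) :
    ‖calK2 c' χ x ((u : ℂ) + t * I) * omegaW D ((u : ℂ) + t * I)‖ ≤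
      (Real.exp 3 * 3 * (39 * DirichletDisc.Zc) * ((1 + ‖iota2‖) * (‖iota3‖ + ‖iota4‖)) *
          72 * 6) * bigP D ^ 12 *
        Real.exp (3 * C * ell D ^ 9 * (1 + 9 * Real.log (ell D))) *
        Real.exp (-(ell D ^ 10) / 4) := by
  obtain ⟨hα0, hα6, hα1⟩ := Step8u016.alpha_small hℓ
  obtain ⟨hwin, hℓ1t0, ht01, hℓ21, hℓ10⟩ := Step8u016.window_sizes hℓ
  have hcα := Step8u016.abs_c_mul_alpha_ell_le_one (c' := c') hℓ hc
  have hπ3 := Real.pi_gt_three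
  have hπ4 := Real.pi_lt_four
  have htabs : |t - 2 * π * t0 D| ≤ ell1 D := by
    rcases ht with ht' | ht'
    · rw [ht', show 2 * π * t0 D + ell1 D - 2 * π * t0 D = ell1 D by ring, abs_of_nonneg hℓ10]
    · rw [ht', show 2 * π * t0 D - ell1 D - 2 * π * t0 D = -ell1 D by ring, abs_neg,
        abs_of_nonneg hℓ10]
  have hπt : π * t0 D ≤ 7 / 2 * t0 D :=
    mul_le_mul_of_nonneg_right (by linarith [Real.pi_lt_d2]) (by linarith)
  have hπt' : 3 * t0 D ≤ π * t0 D := mul_le_mul_of_nonneg_right hπ3.le (by linarith)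
  have ht1 : 1 ≤ t := by rcases ht with ht' | ht' <;> rw [ht'] <;> linarith
  have htle : |t| ≤ 8 * t0 D := by
    rw [abs_of_pos (by linarith)]
    rcases ht with ht' | ht' <;> rw [ht'] <;> linarith
  -- sizes
  have hP0 : 0 < bigP D := Real.exp_pos _
  have hP1 : 1 ≤ bigP D := Real.one_le_exp (pow_nonneg (Real.log_natCast_nonneg D) 9)
  have hp3 := Step8u016.chr_p_le_three_bigP hℓ x
  have hp1 : (1 : ℝ) ≤ x.p := by exact_mod_cast x.prime.one_lt.le
  have ht0P := Step8u016.t0_le_bigP hℓ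
  have hDP := natCast_le_bigP hD
  have hD0 : (0 : ℝ) ≤ D := Nat.cast_nonneg _
  have hP4 := P4_le_bigP_sq hℓ
  have hP40 : 0 ≤ P4 D := Typed.Section16ALeaves.P4_nonneg D
  have hZ1 : 1 ≤ DirichletDisc.Zc := DirichletDisc.one_le_Zc
  set KB : ℝ := (1 + ‖iota2‖) * (‖iota3‖ + ‖iota4‖) with hKB
  have hKB0 : 0 ≤ KB := by rw [hKB]; positivity
  have ht4 : |t| + 4 ≤ 12 * bigP D := by nlinarith
  -- factor 1: `e³ D p t₀ ≤ e³·P·3P·P`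
  have f1 : Real.exp 3 * ((D : ℝ) * x.p * t0 D) ≤ Real.exp 3 * (bigP D * (3 * bigP D) * bigP D) := by
    apply mul_le_mul_of_nonneg_left _ (Real.exp_pos 3).le
    exact mul_le_mul (mul_le_mul hDP hp3 (by positivity) hP0.le) ht0P (by positivity) (by positivity)
  -- factor 2: `p(|t|+5)Z ≤ 3P·13P·Z`
  have f2 : (x.p : ℝ) * (|t| + 5) * DirichletDisc.Zc ≤ 3 * bigP D * (13 * bigP D) * DirichletDisc.Zc := by
    apply mul_le_mul_of_nonneg_right _ (by linarith)
    exact mul_le_mul hp3 (by nlinarith) (by positivity) (by linarith)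
  -- factor 3: the exponent
  have f3 : Real.exp (C * (1 + Real.log (1 / alpha D)) * (Real.log x.p + Real.log (|t| + 4))) ≤
      Real.exp (3 * C * ell D ^ 9 * (1 + 9 * Real.log (ell D))) := by
    rw [Real.exp_le_exp, mul_assoc]
    have h := Step8u016.log_factor_le hℓ hp1 hp3 ht4
    calc C * ((1 + Real.log (1 / alpha D)) * (Real.log x.p + Real.log (|t| + 4)))
        ≤ C * ((1 + 9 * Real.log (ell D)) * (3 * ell D ^ 9)) := mul_le_mul_of_nonneg_left h hC0.le
      _ = 3 * C * ell D ^ 9 * (1 + 9 * Real.log (ell D)) := by ring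
  -- factor 4: `K_B(P+1)² ≤ K_B(2P)²`
  have f4 : KB * (bigP D + 1) ^ 2 ≤ KB * (2 * bigP D) ^ 2 := by
    apply mul_le_mul_of_nonneg_left _ hKB0
    apply pow_le_pow_left₀ (by positivity); linarith
  -- factor 5: `P + 1 ≤ 2P`
  have f5 : bigP D + 1 ≤ 2 * bigP D := by linarith
  -- factor 6: `(2P₄+1)² ≤ (3P²)²`
  have f6 : (2 * P4 D + 1) ^ 2 ≤ (3 * bigP D ^ 2) ^ 2 := by
    apply pow_le_pow_left₀ (by positivity)
    nlinarith [one_le_pow₀ (M₀ := ℝ) hP1 (n := 2)]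
  -- factor 7: the Gaussian
  have f7 : Real.sqrt π / ell2 D * Real.exp (((u - 1 / 2) ^ 2 - (t - 2 * π * t0 D) ^ 2) /
      (4 * ell2 D ^ 2)) ≤ 6 * Real.exp (-(ell D ^ 10) / 4) := by
    have hsq : (t - 2 * π * t0 D) ^ 2 = ell1 D ^ 2 := by
      rcases ht with ht' | ht' <;> rw [ht'] <;> ring
    rw [hsq]
    exact Step8u016.omega_edge_le hℓ (pow_le_one₀ (by linarith) (by linarith))
  -- combine
  have hbase := norm_calK2_omega_le c' x hC h22 hD hp hℓ hα0 hα6 hcα hu1 (by linarith) htabs ht1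
  refine hbase.trans ?_
  have h0f2 : 0 ≤ (x.p : ℝ) * (|t| + 5) * DirichletDisc.Zc := by positivity
  have h0f3 : 0 ≤ Real.exp (C * (1 + Real.log (1 / alpha D)) * (Real.log x.p + Real.log (|t| + 4))) :=
    (Real.exp_pos _).le
  have h0f4 : 0 ≤ KB * (bigP D + 1) ^ 2 := by positivity
  have h0f5 : 0 ≤ bigP D + 1 := by positivity
  have h0f6 : 0 ≤ (2 * P4 D + 1) ^ 2 := by positivity
  have h0ω : 0 ≤ Real.sqrt π / ell2 D *
      Real.exp (((u - 1 / 2) ^ 2 - (t - 2 * π * t0 D) ^ 2) / (4 * ell2 D ^ 2)) :=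
    mul_nonneg (div_nonneg (Real.sqrt_nonneg _) (by linarith)) (Real.exp_pos _).le
  calc Real.exp 3 * ((D : ℝ) * x.p * t0 D) * ((x.p : ℝ) * (|t| + 5) * DirichletDisc.Zc) *
        Real.exp (C * (1 + Real.log (1 / alpha D)) * (Real.log x.p + Real.log (|t| + 4))) *
        (KB * (bigP D + 1) ^ 2) * (bigP D + 1) * (2 * P4 D + 1) ^ 2 *
        (Real.sqrt π / ell2 D *
          Real.exp (((u - 1 / 2) ^ 2 - (t - 2 * π * t0 D) ^ 2) / (4 * ell2 D ^ 2)))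
      ≤ Real.exp 3 * (bigP D * (3 * bigP D) * bigP D) * (3 * bigP D * (13 * bigP D) * DirichletDisc.Zc) *
        Real.exp (3 * C * ell D ^ 9 * (1 + 9 * Real.log (ell D))) *
        (KB * (2 * bigP D) ^ 2) * (2 * bigP D) * (3 * bigP D ^ 2) ^ 2 *
        (6 * Real.exp (-(ell D ^ 10) / 4)) := by
        have g1 := mul_le_mul f1 f2 h0f2 (by positivity)
        have g2 := mul_le_mul g1 f3 h0f3 (by positivity)
        have g3 := mul_le_mul g2 f4 h0f4 (by positivity)
        have g4 := mul_le_mul g3 f5 h0f5 (by positivity)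
        have g5 := mul_le_mul g4 f6 h0f6 (by positivity)
        exact mul_le_mul g5 f7 h0ω (by positivity)
    _ = (Real.exp 3 * 3 * (39 * DirichletDisc.Zc) * KB * 72 * 6) * bigP D ^ 12 *
        Real.exp (3 * C * ell D ^ 9 * (1 + 9 * Real.log (ell D))) *
        Real.exp (-(ell D ^ 10) / 4) := by ring

end EdgeBound

/-! ## The move `𝔍(α) → 𝔍(1)` summed over `Ψ₁` -/

section Assembly

variable (c' : ℝ)

/-- `|(pt₀)^{β₁}| = 1`: `β₁ = iα(1 − 5c′α𝓛)` is purely imaginary and `pt₀ > 0`.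
[cite: Zhang2022LandauSiegel, §2 (2.13)] -/
theorem norm_cpow_beta1 {D : ℕ} (x : Chr D) (hD : 0 < t0 D) :
    ‖(((x.p : ℝ) * t0 D : ℝ) : ℂ) ^ beta1 c' D‖ = 1 := by
  have hp : (0 : ℝ) < (x.p : ℝ) * t0 D := mul_pos (by exact_mod_cast x.prime.pos) hD
  rw [Complex.norm_cpow_eq_rpow_re_of_pos hp]
  have hre : (beta1 c' D).re = 0 := by simp [beta1]
  rw [hre, Real.rpow_zero]

/-- **`Σ_{ψ∈Ψ₁}(p_ψt₀)^{β₁}I₃⁺(ψ) = Θ₂(β₁,𝐤₂*,𝐚₂*) + O(ε)` as an edge from Proposition 2.2 (i)**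
(§16 p. 89: the move "`𝔍(α)` to `𝔍(1)`" of (16.1) restricted to `Ψ₁`, followed by the rewriting u010):
if for `ψ ∈ Ψ₁` the zeros of `L(s,ψ)L(s,ψχ)` in `Ω` lie on the critical line (`Skeleton.Prop22i`), then
for every `c′`, for all large `D`,
`‖Σ_{ψ∈Ψ₁}(p_ψt₀)^{β₁}I₃⁺(ψ) − Θ₂(β₁,κ₂∗b₁,g̃₂)‖ ≤ 1·exp(−𝓛¹⁰/16)`
(`I₃⁺(ψ) = Typed.Section16A.I3pm c′ χ ψ α`). Per `ψ`, Cauchy's theorem on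
`[½+α, 3/2]×[2πt₀−𝓛₁, 2πt₀+𝓛₁]` (`Section7aStatements.norm_intJ_sub_intJ_le`, holomorphy
`differentiableOn_calK2_omega`) leaves the two horizontal sides, each `≤ K·P¹²e^{3C𝓛⁹(1+9log𝓛)}e^{−𝓛¹⁰/4}`
pointwise (`norm_calK2_omega_le_uniform`); `|(p_ψt₀)^{β₁}| = 1`; summing over `#Ψ₁ ≤ 𝔓 ≤ 4P²`
characters and `Step8u016.growth_le` give `e^{−𝓛¹⁰/16}`; finally `Σ_{ψ∈Ψ₁}(p_ψt₀)^{β₁}I₃(ψ;𝔍(1)) = Θ₂`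
exactly (`sum_I3pm_one_eq_Theta2`). [cite: Zhang2022LandauSiegel, §16 (16.1), u010 p.89] -/
theorem sum_I3plus_sub_Theta2_le_of (h22 : Prop22i) :
    ∃ c : ℝ, 0 < c ∧ ∃ C : ℝ, ForAllLarge fun D _ χ =>
      ‖(∑ y ∈ finsetOf (PsiOne χ),
          (((y.p : ℝ) * t0 D : ℝ) : ℂ) ^ beta1 c' D * I3pm c' χ y (alpha D)) -
          Theta2 χ (beta1 c' D) (kappa2Star c' χ) (fun n : ℕ => gTilde16 c' D n)‖ ≤
        C * Real.exp (-c * ell D ^ 10) := by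
  classical
  obtain ⟨C, hC0, hC⟩ := DirichletDisc.exp_neg_le_norm_LFunction
  obtain ⟨D₁, h22'⟩ := h22
  obtain ⟨D₂, hfrakP⟩ := Step8u016.frakP_le_eventually
  -- the constant and the growth threshold on `𝓛`
  set KB : ℝ := (1 + ‖iota2‖) * (‖iota3‖ + ‖iota4‖) with hKB
  have hKB0 : 0 ≤ KB := by rw [hKB]; positivity
  set K : ℝ := Real.exp 3 * 3 * (39 * DirichletDisc.Zc) * KB * 72 * 6 with hK
  have hK0 : 0 ≤ K := by rw [hK]; have := DirichletDisc.one_le_Zc; positivity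
  obtain ⟨D₃, hD₃f⟩ := Skeleton.exists_forall_le_ell
    (max 3 (max (π * |c'| + 1) (max (64 * (4 * K) + 1) ((8 * (14 + 57 * C)) ^ 2))))
  refine ⟨1 / 16, by norm_num, 1, max (max D₁ D₂) (max D₃ 3), fun D _ χ hD hq hp => ?_⟩
  have hD₁ : D₁ ≤ D := le_trans (le_trans (le_max_left _ _) (le_max_left _ _)) hD
  have hD₂ : D₂ ≤ D := le_trans (le_trans (le_max_right _ _) (le_max_left _ _)) hD
  have hD₃ : D₃ ≤ D := le_trans (le_trans (le_max_left _ _) (le_max_right _ _)) hD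
  have hD3 : 3 ≤ D := le_trans (le_trans (le_max_right _ _) (le_max_right _ _)) hD
  have hM := hD₃f D hD₃
  have hℓ3 : 3 ≤ ell D := le_trans (le_max_left _ _) hM
  have hℓc : π * |c'| + 1 ≤ ell D := le_trans (le_trans (le_max_left _ _) (le_max_right _ _)) hM
  have hℓK : 64 * (4 * K) + 1 ≤ ell D :=
    le_trans (le_trans (le_trans (le_max_left _ _) (le_max_right _ _)) (le_max_right _ _)) hM
  have hℓA : (8 * (14 + 57 * C)) ^ 2 ≤ ell D :=
    le_trans (le_trans (le_trans (le_max_right _ _) (le_max_right _ _)) (le_max_right _ _)) hM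
  have hℓ1 : 1 ≤ ell D := by linarith
  have hℓ0 : 0 < ell D := by linarith
  have h22D := h22' D χ hD₁ hq hp
  obtain ⟨hα0, hα6, hα1⟩ := Step8u016.alpha_small hℓ3
  obtain ⟨hwin, -, ht01, -, hℓ10⟩ := Step8u016.window_sizes hℓ3
  have ht0D : 0 < t0 D := by linarith
  have hc8 : π * |c'| ≤ ell D ^ 8 := by
    have : ell D ≤ ell D ^ 8 := by
      calc ell D = ell D ^ 1 := (pow_one _).symm
        _ ≤ ell D ^ 8 := pow_le_pow_right₀ hℓ1 (by norm_num)
    linarith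
  -- the uniform side bound `Mval`
  set Mval : ℝ := K * bigP D ^ 12 * Real.exp (3 * C * ell D ^ 9 * (1 + 9 * Real.log (ell D))) *
    Real.exp (-(ell D ^ 10) / 4) with hMval
  have hMval0 : 0 ≤ Mval := by rw [hMval]; positivity
  -- per character: `‖(pt₀)^{β₁}I₃(α) − (pt₀)^{β₁}I₃(1)‖ ≤ Mval`
  have hper : ∀ y ∈ finsetOf (PsiOne χ),
      ‖(((y.p : ℝ) * t0 D : ℝ) : ℂ) ^ beta1 c' D * I3pm c' χ y (alpha D) -
          (((y.p : ℝ) * t0 D : ℝ) : ℂ) ^ beta1 c' D * I3pm c' χ y 1‖ ≤ Mval := by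
    intro y hy
    have hy' : y ∈ PsiOne χ := mem_of_mem_finsetOf hy
    have h22y : ∀ s ∈ prodZeroSetOmega χ y, s.re = 1 / 2 := h22D y hy'
    have hF := differentiableOn_calK2_omega c' y hD3 hp h22y hα0 hα1 hwin
    have hside : ∀ t : ℝ, (t = 2 * π * t0 D + ell1 D ∨ t = 2 * π * t0 D - ell1 D) →
        ∀ u ∈ Set.Icc (1 / 2 + alpha D) (1 / 2 + 1),
          ‖calK2 c' χ y ((u : ℂ) + ((t : ℝ) : ℂ) * I) * omegaW D ((u : ℂ) + ((t : ℝ) : ℂ) * I)‖ ≤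
            Mval := by
      intro t ht u hu
      have h := norm_calK2_omega_le_uniform c' hC0 hC y h22y hD3 hp hℓ3 hc8 hu.1 hu.2 ht
      rw [hMval, hK, hKB]; exact h
    have hmove := Section7aStatements.norm_intJ_sub_intJ_le D (z₁ := alpha D) (z₂ := 1)
      (M₁ := Mval) (M₂ := Mval) hα1 hF (hside _ (Or.inl rfl)) (hside _ (Or.inr rfl))
    -- `I₃(α) − I₃(1) = (intJ α − intJ 1)/(2πi)`
    have hI : I3pm c' χ y (alpha D) - I3pm c' χ y 1 =
        (Section7aStatements.intJ D (alpha D) (fun s => calK2 c' χ y s * omegaW D s) -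
          Section7aStatements.intJ D 1 (fun s => calK2 c' χ y s * omegaW D s)) / (2 * π * I) := by
      rw [I3pm, I3pm, Step8u016.segInt_eq_intJ_div, Step8u016.segInt_eq_intJ_div, sub_div]
    have hnorm2 : ‖(2 : ℂ) * π * I‖ = 2 * π := by
      rw [norm_mul, norm_mul, Complex.norm_I, mul_one, Complex.norm_real, Real.norm_eq_abs,
        abs_of_pos Real.pi_pos]
      norm_num
    rw [← mul_sub, norm_mul, norm_cpow_beta1 c' y ht0D, one_mul, hI, norm_div, hnorm2, ← norm_neg,
      neg_sub, div_le_iff₀ (by positivity)]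
    calc ‖Section7aStatements.intJ D 1 (fun s => calK2 c' χ y s * omegaW D s) -
          Section7aStatements.intJ D (alpha D) (fun s => calK2 c' χ y s * omegaW D s)‖
        ≤ (1 - alpha D) * (Mval + Mval) := hmove
      _ ≤ 1 * (Mval + Mval) := by gcongr; linarith
      _ ≤ Mval * (2 * π) := by nlinarith [Real.pi_gt_three]
  -- summing over `Ψ₁`
  have hsum : ‖(∑ y ∈ finsetOf (PsiOne χ),
        (((y.p : ℝ) * t0 D : ℝ) : ℂ) ^ beta1 c' D * I3pm c' χ y (alpha D)) -
        Theta2 χ (beta1 c' D) (kappa2Star c' χ) (fun n : ℕ => gTilde16 c' D n)‖ ≤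
      (finsetOf (PsiOne χ)).card * Mval := by
    rw [← sum_I3pm_one_eq_Theta2, ← Finset.sum_sub_distrib]
    calc ‖∑ y ∈ finsetOf (PsiOne χ),
          ((((y.p : ℝ) * t0 D : ℝ) : ℂ) ^ beta1 c' D * I3pm c' χ y (alpha D) -
            (((y.p : ℝ) * t0 D : ℝ) : ℂ) ^ beta1 c' D * I3pm c' χ y 1)‖
        ≤ ∑ y ∈ finsetOf (PsiOne χ),
          ‖(((y.p : ℝ) * t0 D : ℝ) : ℂ) ^ beta1 c' D * I3pm c' χ y (alpha D) -
            (((y.p : ℝ) * t0 D : ℝ) : ℂ) ^ beta1 c' D * I3pm c' χ y 1‖ := norm_sum_le _ _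
      _ ≤ ∑ y ∈ finsetOf (PsiOne χ), Mval := Finset.sum_le_sum hper
      _ = (finsetOf (PsiOne χ)).card * Mval := by rw [Finset.sum_const, nsmul_eq_mul]
  have hcard : ((finsetOf (PsiOne χ)).card : ℝ) ≤ 4 * bigP D ^ 2 :=
    (Ded81Edge.card_finsetOf_psiOne_le_frakP χ).trans (hfrakP D hD₂ hℓ1)
  refine hsum.trans ((mul_le_mul_of_nonneg_right hcard hMval0).trans ?_)
  -- the final size estimate: `4P²·Mval ≤ e^{−𝓛¹⁰/16}`
  have hP : bigP D = Real.exp (ell D ^ 9) := rfl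
  have hgrowth := Step8u016.growth_le hC0.le hℓ1 (by
    calc 8 * (14 + 57 * C) = Real.sqrt ((8 * (14 + 57 * C)) ^ 2) := by
          rw [Real.sqrt_sq (by positivity)]
      _ ≤ Real.sqrt (ell D) := Real.sqrt_le_sqrt hℓA)
  -- `4K ≤ e^{𝓛¹⁰/16}`
  have hconst : 4 * K ≤ Real.exp (ell D ^ 10 / 16) := by
    have h2 : ell D ≤ ell D ^ 10 := by
      calc ell D = ell D ^ 1 := (pow_one _).symm
        _ ≤ ell D ^ 10 := pow_le_pow_right₀ hℓ1 (by norm_num)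
    calc 4 * K ≤ ell D ^ 10 / 16 := by linarith
      _ ≤ ell D ^ 10 / 16 + 1 := by linarith
      _ ≤ Real.exp (ell D ^ 10 / 16) := Real.add_one_le_exp _
  -- `P¹⁴ e^{3C𝓛⁹(1+9log𝓛)} ≤ e^{𝓛¹⁰/8}`
  have hP14 : bigP D ^ 14 = Real.exp (14 * ell D ^ 9) := by
    rw [hP, ← Real.exp_nat_mul]; norm_num
  have hmid : bigP D ^ 14 * Real.exp (3 * C * ell D ^ 9 * (1 + 9 * Real.log (ell D))) ≤
      Real.exp (ell D ^ 10 / 8) := by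
    rw [hP14, ← Real.exp_add, Real.exp_le_exp]
    have : 14 * ell D ^ 9 + 3 * C * ell D ^ 9 * (1 + 9 * Real.log (ell D)) =
        (14 + 3 * C) * ell D ^ 9 + 27 * C * ell D ^ 9 * Real.log (ell D) := by ring
    rw [this]; exact hgrowth
  have e : 4 * bigP D ^ 2 * Mval = (4 * K) *
      (bigP D ^ 14 * Real.exp (3 * C * ell D ^ 9 * (1 + 9 * Real.log (ell D)))) *
      Real.exp (-(ell D ^ 10) / 4) := by
    rw [hMval]; ring
  rw [e]
  have h1 := mul_le_mul hconst hmid (by positivity) (Real.exp_pos _).le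
  have h2 := mul_le_mul_of_nonneg_right h1 (Real.exp_pos (-(ell D ^ 10) / 4)).le
  refine h2.trans (le_of_eq ?_)
  rw [← Real.exp_add, ← Real.exp_add, one_mul]
  congr 1; ring

end Assembly

end Literature.NumberTheory.LFunctions.Zhang2022.Step16u010
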